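import Mathlib
import Summits.Ventures.HodgeRepro.Tier4.Target
import Summits.Ventures.HodgeRepro.Tier4.Line3.Defs
import Summits.Ventures.HodgeRepro.Tier4.Line3.DefsLemmas
import Summits.Ventures.HodgeRepro.Tier4.Line3.LocaliserS
import Summits.Ventures.HodgeRepro.Tier4.Line3.OffMainOrbit
import Summits.Ventures.HodgeRepro.Tier4.Line3.WittSymm
import Summits.Ventures.HodgeRepro.Tier4.Line3.RayMinor
import Summits.Ventures.HodgeRepro.Tier4.Line3.CrossMinor

/-!
# Tier4/Line3/ScalarFamily — the PER-SLOT scalar support clause, the scalar family of the ray, the rank-one ray and the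
Witt / rank-one step (t4-x2 g2, S13421 (2)–(3); TEXT OF RECORD for L3 v0.39 by t4-plan-3 g3's adjudication S13492 (1))

Blind re-derivation cell `pub-hodge-repro`, Tier 4 «PROVE THE STEP» (README §9–§10), LINE L3, seat t4-x2 (reserve
wall-breaker, g2).  The degree-4 invariant `crossMinor`, its module and the size rung are t4-L2-p3 g3's `CrossMinor`
(p679339, imported by name: `crossMinor xm x i j k l = G_ij(x) G_kl(x) G_il G_kj − G_il(x) G_kj(x) G_ij G_kl`,
`crossMinor_mem`, `exists_crossMinor_size`, and the per-slot support clause `SuppSlot`); this module adds the SETS and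
the Witt step.

## Why per slot (S13421 (2)–(3), crit-2 S13431 (a)–(b), crit-1 S13433)

`coefQ` is a sum of PRODUCTS over the four slots, each slot carrying its own Hecke translate of its own slot function; the
scalar symmetry of O-L3-8 is therefore per slot (`LocSScalarObstructionGen`), and the support of the natural localiser at
depth `N` is the product of the four saturated balls `U · xm_j + ball_N`.  A support clause with ONE scalar for the four
slots (`RayMinor.SuppU`) is unsatisfiable for the same reason as `LocS.supp`; the honest clause carries a scalar per slot
(`SuppSlot` = `SuppU4`).  The orbits persisting at every depth are then the per-slot scalar copies `(β₀ a, β₁ b, β₂ a, β₃ b)`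
of the RAY elements (`ScalarFamily`), not the ray alone (`(2a, b, a, b)` is off the ray).

## The sets

* `ScalarFamily xm` — the orbits of the per-slot scalar copies `(β j • y j)_j` of the ray elements `y`
  (`Gram(y) = ρ · Gram(xm)`), all `β j ≠ 0`; contains `GramRay xm`.
* `RankOneRay xm` — the orbits of tuples all of whose cross products with `xm` vanish: what the degree-4 rung SEES.
  `ScalarFamily xm ⊆ RankOneRay xm` (`crossMinor_smul_ray`: the per-slot twist cancels), and CONVERSELY
  (`mem_scalarFamily_of_crossMinor_eq_zero`) a tuple without a zero slot all of whose cross products with a centre with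
  non-zero Gram entries vanish is a per-slot scalar copy of a ray element: `β_j := G_0j(x) / G_0j`, `ρ := G_00 / G_00(x)`,
  `y := β⁻¹ • x` (the first row of `x` is non-zero from the cross product `(j, j, 0, 0)` and anisotropy; the identity
  `G_ij(x) = G_00 G_i0(x) G_0j(x) G_ij / (G_00(x) G_i0 G_0j)` is the cross product `(i, j, 0, 0)`; hermitian symmetry from
  `WittSymm.hform_symm`).  So `RankOneRay xm ∖ ScalarFamily xm` consists of orbits with a ZERO SLOT
  (`exists_zero_slot_of_mem_rankOneRay_not_mem_scalarFamily`) when `h(xm_i, xm_j) ≠ 0` for all `i, j`.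

Nothing here asserts anything about the truth of (P); HC_CM is NOT proved by anyone in this repository.
-/

set_option autoImplicit false

noncomputable section

namespace Summit.Ventures.HodgeRepro.Tier4.Line3

open Summit.Ventures.HodgeRepro.Tier4
open NumberField

open scoped Classical

namespace T4Data

variable (X : T4Data)

/-! ### 1. The per-slot scalar support clause and the scalar family -/

/-- **THE PER-SLOT SCALAR-COPY SUPPORT CLAUSE** (S13421 (2)) — the name of the v0.39 design; it IS `CrossMinor.SuppSlot`
(t4-L2-p3 g3), one spelling: every line tuple carrying a non-zero coefficient of the depth-`N` localiser has a representative
`x` with `x j` in the depth-`N` ball around `lam j • xm j ∈ L`, `L` in a fixed finite set of lattices containing `xm`. -/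
def SuppU4 (D : X.ThetaData) (p : IsDedekindDomain.HeightOneSpectrum (RingOfIntegers X.E)) (xm : X.Tuple)
    {level : ℕ → X.Level} (loc : ∀ N, X.Tr (level N)) : Prop :=
  X.SuppSlot D p xm loc

/-- `SuppU4` is `SuppSlot`. -/
theorem suppU4_iff_suppSlot (D : X.ThetaData) (p : IsDedekindDomain.HeightOneSpectrum (RingOfIntegers X.E))
    (xm : X.Tuple) {level : ℕ → X.Level} (loc : ∀ N, X.Tr (level N)) :
    X.SuppU4 D p xm loc ↔ X.SuppSlot D p xm loc := Iff.rfl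

/-- The one-scalar clause (`RayMinor.SuppU`) implies the per-slot one (`lam j := l`). -/
theorem suppU4_of_suppU (D : X.ThetaData) (p : IsDedekindDomain.HeightOneSpectrum (RingOfIntegers X.E))
    (xm : X.Tuple) {level : ℕ → X.Level} (loc : ∀ N, X.Tr (level N)) (h : X.SuppU D p xm loc) :
    X.SuppU4 D p xm loc := by
  obtain ⟨S, hS, hsupp⟩ := h
  refine ⟨S, hS, fun N w hw => ?_⟩
  obtain ⟨l, x, L, hL, hl0, hl, hx, hlines⟩ := hsupp N w hw
  exact ⟨fun _ => l, x, L, hL, fun j => ⟨hl0, hl j, hx j⟩, hlines⟩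

/-- **THE SCALAR FAMILY OF THE RAY** (S13421 (3)): the orbits of the per-slot scalar copies `(β j • y j)_j` of the
elements `y` of the Gram ray (`Gram(y) = ρ · Gram(xm)`), all `β j ≠ 0`. -/
def ScalarFamily (xm : X.Tuple) : Set X.Orbit :=
  {o | ∃ (y : X.Tuple) (β : Fin 4 → X.E) (ρ : X.E), (∀ j, β j ≠ 0) ∧ (∀ i j, X.gram y i j = ρ * X.gram xm i j) ∧
    X.orbitOf (X.lines (fun j => β j • y j)) = o}

/-- The Gram ray lies in its scalar family (`β = 1`). -/
theorem gramRay_subset_scalarFamily (xm : X.Tuple) : X.GramRay xm ⊆ X.ScalarFamily xm := by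
  rintro o ⟨y, ρ, rfl, hy⟩
  refine ⟨y, fun _ => 1, ρ, fun _ => one_ne_zero, hy, ?_⟩
  simp

/-- The main orbit lies in the scalar family. -/
theorem orbitOf_lines_mem_scalarFamily (xm : X.Tuple) : X.orbitOf (X.lines xm) ∈ X.ScalarFamily xm :=
  X.gramRay_subset_scalarFamily xm (X.orbitOf_lines_mem_gramRay xm)

/-! ### 2. The rank-one ray: what the degree-4 rung sees -/

/-- **THE RANK-ONE RAY**: the orbits of tuples all of whose cross products with `xm` vanish. -/
def RankOneRay (xm : X.Tuple) : Set X.Orbit :=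
  {o | ∃ y : X.Tuple, X.orbitOf (X.lines y) = o ∧ ∀ i j k l, X.crossMinor xm y i j k l = 0}

/-- **OFF THE RANK-ONE RAY, SOME CROSS PRODUCT IS NON-ZERO.** -/
theorem exists_crossMinor_ne_of_not_mem_rankOneRay (xm x : X.Tuple)
    (hne : X.orbitOf (X.lines x) ∉ X.RankOneRay xm) : ∃ i j k l, X.crossMinor xm x i j k l ≠ 0 := by
  by_contra hall
  apply hne
  refine ⟨x, rfl, fun i j k l => ?_⟩
  by_contra h
  exact hall ⟨i, j, k, l, h⟩

/-- Every cross product vanishes on a per-slot scalar copy of a ray element (the twist `c(β_i) β_j c(β_k) β_l` is common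
to both products). -/
theorem crossMinor_smul_ray (xm y : X.Tuple) (β : Fin 4 → X.E) (ρ : X.E)
    (hy : ∀ i j, X.gram y i j = ρ * X.gram xm i j) (i j k l : Fin 4) :
    X.crossMinor xm (fun j => β j • y j) i j k l = 0 := by
  unfold crossMinor
  rw [X.gram_slot_smul y β i j, X.gram_slot_smul y β k l, X.gram_slot_smul y β i l, X.gram_slot_smul y β k j,
    hy i j, hy k l, hy i l, hy k j]
  ring

/-- The scalar family lies in the rank-one ray. -/
theorem scalarFamily_subset_rankOneRay (xm : X.Tuple) : X.ScalarFamily xm ⊆ X.RankOneRay xm := by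
  rintro o ⟨y, β, ρ, -, hy, rfl⟩
  exact ⟨fun j => β j • y j, rfl, fun i j k l => X.crossMinor_smul_ray xm y β ρ hy i j k l⟩

/-! ### 3. The Witt / rank-one step: the rank-one ray is the scalar family off the zero slots -/

/-- The Gram matrix is `c`-hermitian: `G_ji(x) = c (G_ij(x))`. -/
theorem gram_symm (x : X.Tuple) (i j : Fin 4) : X.gram x j i = X.c (X.gram x i j) :=
  hform_symm X.c X.H X.hHerm X.c_c (x i) (x j)

/-- **THE RANK-ONE RAY IS THE SCALAR FAMILY**: a tuple without a zero slot all of whose cross products with a centre with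
non-zero Gram entries vanish is a per-slot scalar copy of a ray element (`β_j := G_0j(x) / G_0j`, `ρ := G_00 / G_00(x)`). -/
theorem mem_scalarFamily_of_crossMinor_eq_zero (xm x : X.Tuple) (hG : ∀ i j, X.gram xm i j ≠ 0)
    (hx0 : ∀ j, x j ≠ 0) (hcross : ∀ i j k l, X.crossMinor xm x i j k l = 0) :
    X.orbitOf (X.lines x) ∈ X.ScalarFamily xm := by
  -- the diagonal entries of `x` are non-zero (anisotropy)
  have hxx : ∀ j, X.gram x j j ≠ 0 := fun j h => hx0 j (X.hAn _ h)
  -- the first row of `x` is non-zero: from `crossMinor xm x j j 0 0 = 0`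
  have hx0j : ∀ j, X.gram x 0 j ≠ 0 := by
    intro j h
    have hc := hcross j j 0 0
    unfold crossMinor at hc
    rw [X.gram_symm x 0 j, h, map_zero] at hc
    have : X.gram x j j * X.gram x 0 0 * (X.gram xm j 0 * X.gram xm 0 j) = 0 := by linear_combination hc
    rcases mul_eq_zero.mp this with h1 | h1
    · rcases mul_eq_zero.mp h1 with h2 | h2
      · exact hxx j h2
      · exact hxx 0 h2
    · rcases mul_eq_zero.mp h1 with h2 | h2
      · exact hG j 0 h2
      · exact hG 0 j h2
  have hxi0 : ∀ i, X.gram x i 0 ≠ 0 := fun i => by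
    rw [X.gram_symm x 0 i]
    exact (RingEquiv.map_ne_zero_iff X.c).mpr (hx0j i)
  set β : Fin 4 → X.E := fun j => X.gram x 0 j / X.gram xm 0 j with hβ
  have hβ0 : ∀ j, β j ≠ 0 := fun j => div_ne_zero (hx0j j) (hG 0 j)
  set ρ : X.E := X.gram xm 0 0 / X.gram x 0 0 with hρ
  have hcβ : ∀ i, X.c (β i) = X.gram x i 0 / X.gram xm i 0 := by
    intro i
    simp only [hβ, map_div₀]
    rw [← X.gram_symm x 0 i, ← X.gram_symm xm 0 i]
  -- the key identity `G_ij(x) = G_00 G_i0(x) G_0j(x) G_ij / (G_00(x) G_i0 G_0j)`, from the cross product `(i, j, 0, 0)`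
  have key' : ∀ i j, X.gram x i j =
      (X.gram xm 0 0 * X.gram x i 0 * X.gram x 0 j * X.gram xm i j) /
        (X.gram x 0 0 * X.gram xm i 0 * X.gram xm 0 j) := by
    intro i j
    have hc := hcross i j 0 0
    unfold crossMinor at hc
    rw [eq_div_iff (mul_ne_zero (mul_ne_zero (hxx 0) (hG i 0)) (hG 0 j))]
    linear_combination hc
  refine ⟨fun j => (β j)⁻¹ • x j, β, ρ, hβ0, fun i j => ?_, ?_⟩
  · rw [X.gram_slot_smul x (fun j => (β j)⁻¹) i j, map_inv₀, hcβ i, key' i j]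
    simp only [hβ, hρ]
    have h1 := hxi0 i
    have h2 := hx0j j
    have h3 := hxx 0
    have h4 := hG i 0
    have h5 := hG 0 j
    have h6 := hG 0 0
    field_simp
  · have hfun : (fun j => β j • (fun j => (β j)⁻¹ • x j) j) = x := by
      funext j
      simp only [smul_smul, mul_inv_cancel₀ (hβ0 j), one_smul]
    rw [hfun]

/-- **A RANK-ONE ORBIT OFF THE SCALAR FAMILY HAS A ZERO SLOT** (centre with non-zero Gram entries): the orbits of
`RankOneRay xm ∖ ScalarFamily xm` carry a representative with some `x j = 0`. -/
theorem exists_zero_slot_of_mem_rankOneRay_not_mem_scalarFamily (xm : X.Tuple) (hG : ∀ i j, X.gram xm i j ≠ 0)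
    {o : X.Orbit} (hR : o ∈ X.RankOneRay xm) (hF : o ∉ X.ScalarFamily xm) :
    ∃ x : X.Tuple, X.orbitOf (X.lines x) = o ∧ ∃ j, x j = 0 := by
  obtain ⟨x, rfl, hcross⟩ := hR
  refine ⟨x, rfl, ?_⟩
  by_contra hall
  push Not at hall
  exact hF (X.mem_scalarFamily_of_crossMinor_eq_zero xm x hG hall hcross)

end T4Data

end Summit.Ventures.HodgeRepro.Tier4.Line3

end
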